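import Summits.BirchSwinnertonDyer.BirchSwinnertonDyer.Theorems.UniversalToricDescentToricTransportModThreeNormProfile
import Summits.BirchSwinnertonDyer.Rank1Residual.X2.HidaLimitCongruenceAlgebra
import Literature.NumberTheory.EllipticCurves.IwasawaAlgebraCharIdealProofs
import HarnessLib

/-!
# Stub `stub_ratSqueeze` of line `ratwall_thin_comb` (v2) on the UTD parent crux `ToricTransportModThree`
# (stmt-BirchSwinnertonDyer-20186) — CLOSED (LEAD bsd-wall-utd-p1 g19, 2026-08-29)

Pure algebra in `R₀⟦T⟧ = UnrSeries 3` (`R₀ = unrIntegers 3`, a discrete valuation ring with uniformiser `3`):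
if `I = (g)` with `‖g_i‖ < 1` for `i < n` and `‖g_n‖ = 1`, `‖L_n‖ = 1`, and `3^k·L ∈ I`, then `I = (L)`.

Proof: `‖g_n‖ = 1` forbids `3 ∣ g` (a multiple of `3` has all coefficients of norm `≤ 3⁻¹`); `3 = C 3` is PRIME in
`R₀⟦T⟧` (`prime_C_of_prime` + `irreducible_natCast_p` in the DVR `R₀`); peeling the `3`'s off `g ∣ 3^k·L` one at a time
(primality + cancellation in the domain `R₀⟦T⟧`) gives `g ∣ L`; then the landed norm-profile squeeze
`UniversalToricDescentNormProfile.span_eq_span_of_dvd_of_normProfile` gives `(g) = (L)`.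

This is the registered signature VERBATIM (skeleton v2 sha16 2f6f153a9e914ebb, `ledger skeleton check` 2026-08-29), in the
skeleton's namespace. References: [Washington1997] §7.1 (structure of `𝒪⟦T⟧`); folklore.
-/

set_option linter.dupNamespace false
set_option autoImplicit false

noncomputable section

open Literature.NumberTheory.EllipticCurves
open Literature.NumberTheory.LFunctions.Dwork (norm_natCast_p_padicComplex)
open Summit.BirchSwinnertonDyer.BirchSwinnertonDyer.Theorems.UniversalToricDescentNormProfile

namespace Summit.BirchSwinnertonDyer.BirchSwinnertonDyer.Cruxes.ToricTransportModThree.RatwallThinComb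

/-- In a domain: if `π` is prime and `π ∤ g`, then `g ∣ π^k·m` forces `g ∣ m` (peel one `π` at a time:
`π^{k+1} m = g h` gives `π ∣ h` by primality, then cancel `π`). [folklore] -/
theorem dvd_of_dvd_prime_pow_mul {R : Type*} [CommRing R] [IsDomain R] {π g m : R} (hπ : Prime π)
    (hg : ¬ π ∣ g) : ∀ k : ℕ, g ∣ π ^ k * m → g ∣ m
  | 0, h => by simpa using h
  | k + 1, ⟨h, hh⟩ => by
      have hgh : π ∣ g * h := ⟨π ^ k * m, by rw [← hh]; ring⟩
      rcases hπ.dvd_or_dvd hgh with hπg | ⟨h', rfl⟩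
      · exact absurd hπg hg
      · refine dvd_of_dvd_prime_pow_mul hπ hg k ⟨h', mul_left_cancel₀ hπ.ne_zero ?_⟩
        rw [← mul_assoc, ← pow_succ', hh]
        ring

/-- `3 = C 3` is a prime element of `R₀⟦T⟧` (`R₀` is a DVR with uniformiser `3`). [folklore] -/
theorem prime_C_three : Prime (PowerSeries.C ((3 : ℕ) : unrIntegers 3) : UnrSeries 3) := by
  haveI := Summit.BirchSwinnertonDyer.Rank1Residual.X2.HidaLimitAlgebra.isDiscreteValuationRing_unrIntegers (p := 3)
  exact prime_C_of_prime
    (Summit.BirchSwinnertonDyer.Rank1Residual.X2.HidaLimitAlgebra.irreducible_natCast_p (p := 3)).prime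

/-- A series with a coefficient of norm `1` is not divisible by `3` in `R₀⟦T⟧` (`μ = 0`): every coefficient of
`3·h` has norm `‖3‖·‖h_n‖ ≤ 3⁻¹ < 1`. [folklore] -/
theorem not_C_three_dvd_of_norm_coeff_eq_one {g : UnrSeries 3} {n : ℕ}
    (hgn : ‖((PowerSeries.coeff n g : unrIntegers 3) : ℂ_[3])‖ = 1) :
    ¬ (PowerSeries.C ((3 : ℕ) : unrIntegers 3) : UnrSeries 3) ∣ g := by
  rintro ⟨h, rfl⟩
  rw [PowerSeries.coeff_C_mul, Subring.coe_mul, norm_mul, SubringClass.coe_natCast,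
    norm_natCast_p_padicComplex] at hgn
  have hle : ‖((PowerSeries.coeff n h : unrIntegers 3) : ℂ_[3])‖ ≤ 1 := norm_coeff_le_one h n
  have h3 : ((3 : ℕ) : ℝ)⁻¹ < 1 := by norm_num
  have : ((3 : ℕ) : ℝ)⁻¹ * ‖((PowerSeries.coeff n h : unrIntegers 3) : ℂ_[3])‖ < 1 := by
    calc ((3 : ℕ) : ℝ)⁻¹ * ‖((PowerSeries.coeff n h : unrIntegers 3) : ℂ_[3])‖
        ≤ ((3 : ℕ) : ℝ)⁻¹ * 1 := mul_le_mul_of_nonneg_left hle (by positivity)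
      _ < 1 := by rw [mul_one]; exact h3
  exact absurd hgn (ne_of_lt this)

/-- **`stub_ratSqueeze`** (registered stub of line `ratwall_thin_comb` v2 on stmt-BirchSwinnertonDyer-20186, VERBATIM):
`I = (g)`, `‖g_i‖ < 1 (i < n)`, `‖g_n‖ = 1`, `‖L_n‖ = 1`, `3^k·L ∈ I` ⟹ `I = (L)`. [folklore; Washington1997 §7.1] -/
theorem stub_ratSqueeze :
    ∀ (I : Ideal (UnrSeries 3)) (g L : UnrSeries 3) (n k : ℕ), I = Ideal.span {g} →
      (∀ i < n, ‖((PowerSeries.coeff i g : unrIntegers 3) : ℂ_[3])‖ < 1) →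
      ‖((PowerSeries.coeff n g : unrIntegers 3) : ℂ_[3])‖ = 1 →
      ‖((PowerSeries.coeff n L : unrIntegers 3) : ℂ_[3])‖ = 1 →
      ((3 : ℕ) : UnrSeries 3) ^ k * L ∈ I → I = Ideal.span {L} := by
  intro I g L n k hI hg hgn hLn hmem
  subst hI
  have hgdvd : g ∣ ((3 : ℕ) : UnrSeries 3) ^ k * L := Ideal.mem_span_singleton.mp hmem
  rw [← map_natCast (PowerSeries.C (R := unrIntegers 3))] at hgdvd
  exact span_eq_span_of_dvd_of_normProfile
    (dvd_of_dvd_prime_pow_mul prime_C_three (not_C_three_dvd_of_norm_coeff_eq_one hgn) k hgdvd) hg hLn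

end Summit.BirchSwinnertonDyer.BirchSwinnertonDyer.Cruxes.ToricTransportModThree.RatwallThinComb

end
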